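import Summits.Ventures.PercRepro.RankLevelSetCoreSevenOfFormSplitKY
import Summits.Ventures.PercRepro.RankLevelSetSplitKYCountGiant

/-!
# PercRepro — THE `e`-FREE CORE AT LEVEL `7` FROM A NUMERIC FORM WITH THE GIANT TERM AND THE SPANNING BOUND AS PARAMETERS
(`k = 0`, the count case only) (p9, gen 29; S4 — the cells `(37, 71 … 73)` of the `q = 7` window)

p8 g21's `c025_core_seven_of_form_splitky` (RankLevelSetCoreSevenOfFormSplitKY) restricted to `k = 0` and to the count-based
`Y`-tail (`47 ≤ d`), with two quantities that the original fixes from the `e`-free flat bound `f(7) ≤ 79` and the crude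
spanning count `Σ_{j ≤ d} C(n, j)` taken as HYPOTHESES: the giant term `G` — `hU0` is the telescoping count at `k = 0` with
its powerset term `2^{min 79 (7 + d)}` replaced by `G`, `hall` the count of ALL rank-`7` sets through the rank-`7` sets of
size `≤ d` plus `G` — and the spanning bound `TA` (`hB`). The numeric form is then `c₁·(nsideTelK7 − 2^{…} + G) ≤ c₂·B` on
the `N`-side and `c₁·((nsideTelK7 − 2^{…} + G + G) + rest₆ + TA) ≤ (c₁ − c₂)·2^n` on the `Y`-side. The cells `(37, 71 … 73)`
use it twice: with `G = 2^{d − 3}` when every rank-`≤ 7` set has `≤ d − 3` points (S2GiantAllLevels /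
S2TelescopeCount7 at `f = d − 3`), and with `G = 2^{min 79 (7 + d)}` and p7 g12's concentrated spanning tail
(S2SpanningCount) when some rank-`≤ 7` set has `≥ d − 2` points (RankLevelSetBigFlatCells). Axioms: standard.
-/

set_option exponentiation.threshold 1024

open scoped Matroid

namespace PercRepro

namespace ThmN

open Set

variable {α : Type}

/-- **The `e`-free core at level `7` from a numeric form, `k = 0`, with the giant term `G` and the spanning bound `TA` as
parameters** (p8's `c025_core_seven_of_form_splitky`, the count case): `hU0` = the telescoping count at `k = 0` with the
powerset term `G`, `hall` = every rank-`7` set is of size `≤ d` or lies among `G` sets, `hB` = the spanning sets number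
`≤ TA`; the form `(c₁, c₂)`: `c₁·(nsideTelK7 p d 0 S3 S4 S5 − 2^{min 79 (7 + d − 0)} + G) ≤ c₂·2^{d−7}·C(p+7, 7)` and
`c₁·((nsideTelK7 p d 0 S3 S4 S5 − 2^{min 79 (7 + d − 0)} + G + G) + rest₆ + TA) ≤ (c₁ − c₂)·2^{p+d}`; `13 ≤ n`. -/
theorem c025_core_seven_of_form_tel_giant (M : Matroid α) [M.Finite] (p d S3 S4 S5 : ℕ) (G TA : ℕ) (hd8 : 8 ≤ d)
    (hR : M.eRank = (p : ℕ∞)) (hn : M.E.ncard = p + d)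
    (hfree : ∀ e ∈ M.E, ∃ A ⊆ M.E \ {e}, e ∉ M.closure A ∧ e ∉ M.closure ((M.E \ {e}) \ A))
    (hs3 : {C | M.IsCircuit C ∧ C.ncard = 3}.ncard ≤ S3)
    (hs4 : {C | M.IsCircuit C ∧ C.ncard = 4}.ncard ≤ S4)
    (hs5 : {C | M.IsCircuit C ∧ C.ncard = 5}.ncard ≤ S5)
    (hn13 : 13 ≤ p + d)
    (hU0 : ({B : Set α | B ⊆ M.E ∧ M.eRk B = (7 : ℕ) ∧ B.ncard ≤ d}.ncard : ℚ) ≤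
      ({B : Set α | B ⊆ M.E ∧ M.eRk B = (7 : ℕ) ∧ B.ncard = 7}.ncard : ℚ) +
        (∑ j ∈ Finset.range (d - 7), S2.lamTel (((p + d).choose 7 : ℕ) : ℚ)
          ((({C | M.IsCircuit C ∧ C.ncard = 3}.ncard : ℕ) : ℚ) * (((p + d - 3).choose 5 : ℕ) : ℚ) +
            (({C | M.IsCircuit C ∧ C.ncard = 4}.ncard : ℕ) : ℚ) * (((p + d - 4).choose 4 : ℕ) : ℚ) +
            (({C | M.IsCircuit C ∧ C.ncard = 5}.ncard : ℕ) : ℚ) * (((p + d - 5).choose 3 : ℕ) : ℚ) +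
            (({C | M.IsCircuit C ∧ C.ncard = 6}.ncard : ℕ) : ℚ) * (((p + d - 6).choose 2 : ℕ) : ℚ) +
            (({C | M.IsCircuit C ∧ C.ncard = 7}.ncard : ℕ) : ℚ) * (((p + d - 7 : ℕ)) : ℚ) +
            (({C | M.IsCircuit C ∧ C.ncard = 8}.ncard : ℕ) : ℚ) * ((1 : ℕ) : ℚ))
          (min (min 79 (7 + d - 0) - 8) (max ((d + min 33 d) / 2 + 1) (min 32 (d - 1) + 2) - 2))
          (fun ν => ν + S2.rminF ν) (j + 1)) + (G : ℚ))
    (hall : {X : Set α | X ⊆ M.E ∧ M.eRk X = 7}.ncard ≤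
      {X : Set α | X ⊆ M.E ∧ M.eRk X = 7 ∧ X.ncard ≤ d}.ncard + G)
    (hB : {X : Set α | X ⊆ M.E ∧ M.eRk X = M.eRank}.ncard ≤ TA)
    (hform :
      ∃ c₁ c₂ : ℕ, 0 < c₂ ∧ c₂ < c₁ ∧
      ((c₁ : ℕ) : ℚ) * (nsideTelK7 p d 0 S3 S4 S5 - (2 : ℚ) ^ (min 79 (7 + d - 0)) + (G : ℚ)) ≤
        ((c₂ : ℕ) : ℚ) * 2 ^ (d - 7) * (((p + 7).choose 7 : ℕ) : ℚ) ∧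
      ((c₁ : ℕ) : ℚ) * ((nsideTelK7 p d 0 S3 S4 S5 - (2 : ℚ) ^ (min 79 (7 + d - 0)) + (G : ℚ) + (G : ℚ)) +
          (((p + d).choose 6 * 2 ^ (min 33 d) + (p + d).choose 5 * 2 ^ (min 14 d) + (p + d).choose 4 * 2 ^ 6 +
            (p + d).choose 3 * 2 ^ 3 + (p + d).choose 2 * 2 + (p + d) + 1 + TA : ℕ) : ℚ)) ≤
        ((c₁ - c₂ : ℕ) : ℚ) * 2 ^ (p + d)) :
    RLS M p 7 := by
  classical
  have hEcard : M.ground_finite.toFinset.card = p + d := by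
    rw [← Set.ncard_eq_toFinset_card _ M.ground_finite]; exact hn
  -- the core is simple: every circuit has `≥ 3` elements
  have hL0 : ∀ e ∈ M.E, ¬ M.IsLoop e := not_isLoop_of_free M hfree
  have hs : ∀ e ∈ M.E, ∀ f ∈ M.E, e ≠ f → M.eRk {e, f} = 2 := by
    intro e he f hf hef
    have h2 : (2 : ℕ∞) ≤ M.eRk {e, f} :=
      two_le_eRk_of_two_le_ncard_of_free M hfree (pair_subset he hf) (by rw [ncard_pair hef])
    have h3 : M.eRk {e, f} ≤ 2 := by
      have := M.eRk_le_encard {e, f}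
      rwa [encard_pair hef] at this
    exact le_antisymm h3 h2
  have hcirc : ∀ C, M.IsCircuit C → 3 ≤ C.encard := three_le_encard_of_circuit M hL0 hs
  have hd : M.E.encard = M.eRank + d := by
    rw [hR, ← M.ground_finite.cast_ncard_eq, hn]
    push_cast
    ring
  -- the nullity cap: every `X ⊆ E` has `|X| ≤ r(X) + d`
  have hcap : ∀ X ⊆ M.E, ∀ k : ℕ, M.eRk X ≤ k → X.ncard ≤ k + d := by
    intro X hX k hr
    have h1 := Matroid.encard_le_eRk_add_of_encard_eq hX hd
    have h2 : X.encard ≤ (k : ℕ∞) + d := h1.trans (by gcongr)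
    have hfin : X.Finite := M.ground_finite.subset hX
    rw [← hfin.cast_ncard_eq] at h2
    exact_mod_cast h2
  -- rank-`≤ 7` sets have `≤ min 79 (7 + d)` points, rank-`≤ 6` sets `≤ min 39 (6 + d)`
  have hflat : ∀ X ⊆ M.E, M.eRk X ≤ 7 → X.ncard ≤ min 79 (7 + d) :=
    fun X hX hr => le_min (ncard_le_seventynine_of_eRk_le_seven_of_free M hfree X hX hr) (hcap X hX 7 hr)
  have hflat' : ∀ X ⊆ M.E, M.eRk X ≤ ((7 - 1 : ℕ) : ℕ∞) → X.ncard ≤ min 39 (6 + d) :=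
    fun X hX hr => le_min (ncard_le_thirtynine_of_eRk_le_six_of_free M hfree hX (by simpa using hr))
      (hcap X hX 6 (by simpa using hr))
  have hinter := hinter_seven M hd hfree
  -- the flat bounds of the `e`-free core at every rank `≤ 6`
  have hC1 : ∀ L ⊆ M.E, M.eRk L = 2 → L.ncard ≤ 3 :=
    fun L hL hr => ncard_le_three_of_eRk_two M hs hfree hL hr
  have hC2 : ∀ P ⊆ M.E, M.eRk P ≤ 3 → P.ncard ≤ 6 :=
    fun P hP hr => ncard_le_six_of_eRk_le_three_of_free M hfree hP hr
  have hf0 : ∀ X ⊆ M.E, M.eRk X ≤ 0 → X.ncard ≤ 0 := fun X hX hr => by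
    have := ncard_add_one_le_two_pow_of_eRk_le M hL0 hfree 0 X hX (by exact_mod_cast hr)
    omega
  have hf1 : ∀ X ⊆ M.E, M.eRk X ≤ 1 → X.ncard ≤ 1 := fun X hX hr => by
    have := ncard_add_one_le_two_pow_of_eRk_le M hL0 hfree 1 X hX (by exact_mod_cast hr)
    omega
  have hf2 : ∀ X ⊆ M.E, M.eRk X ≤ 2 → X.ncard ≤ 3 := fun X hX hr => by
    have := ncard_add_one_le_two_pow_of_eRk_le M hL0 hfree 2 X hX (by exact_mod_cast hr)
    omega
  have hf4 : ∀ X ⊆ M.E, M.eRk X ≤ 4 → X.ncard ≤ 10 :=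
    fun X hX hr => ncard_le_ten_of_eRk_le_four_of_free M hfree hX hr
  have hf5 : ∀ X ⊆ M.E, M.eRk X ≤ 5 → X.ncard ≤ 19 :=
    fun X hX hr => ncard_le_nineteen_of_eRk_le_five_of_free M hfree hX hr
  have hf6 : ∀ X ⊆ M.E, M.eRk X ≤ 6 → X.ncard ≤ 39 :=
    fun X hX hr => ncard_le_thirtynine_of_eRk_le_six_of_free M hfree hX hr
  -- the circuit counts beyond `5`: the nullity bounds
  have hs6 : {C | M.IsCircuit C ∧ C.ncard = 6}.ncard ≤ (d + 5).choose 6 :=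
    Matroid.ncard_circuits_le_choose_of_encard M hd 5
  have hs7 : {C | M.IsCircuit C ∧ C.ncard = 7}.ncard ≤ (d + 6).choose 7 :=
    Matroid.ncard_circuits_le_choose_of_encard M hd 6
  have hs8 : {C | M.IsCircuit C ∧ C.ncard = 8}.ncard ≤ (d + 7).choose 8 :=
    Matroid.ncard_circuits_le_choose_of_encard M hd 7
  -- (U): the telescoping count, in `ℚ`, then the circuit bounds
  have hU1 := Matroid.topCount_le_ncard_compl (M := M) hR hd 7
  -- (Y): the rank-`≤ 7` sets through their closures; the spanning sets by the `5/2` tail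
  have hY := Matroid.two_pow_le_midCount_add (M := M) p 7 hR
  have hsum7 := S2.ncard_eRk_le_le_sum M 7
  simp only [Finset.sum_range_succ, Finset.sum_range_zero, zero_add] at hsum7
  rw [hEcard] at hY
  obtain ⟨c₁, c₂, hc₂, hc₁₂, hN, hT⟩ := hform
  have h7 : {X : Set α | X ⊆ M.E ∧ M.eRk X = (7 : ℕ)}.ncard ≤ M.E.ncard.choose 7 * 2 ^ (min 72 d) := by
    have := S2.ncard_eRk_eq_le_choose_mul_two_pow M 7 (min 79 (7 + d))
      (fun X hX hr => hflat X hX (by exact_mod_cast hr))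
    rwa [show min 79 (7 + d) - 7 = min 72 d by omega] at this
  have h6 : {X : Set α | X ⊆ M.E ∧ M.eRk X = (6 : ℕ)}.ncard ≤ M.E.ncard.choose 6 * 2 ^ (min 33 d) := by
    have := S2.ncard_eRk_eq_le_choose_mul_two_pow M 6 (min 39 (6 + d))
      (fun X hX hr => le_min (ncard_le_thirtynine_of_eRk_le_six_of_free M hfree hX (by exact_mod_cast hr))
        (hcap X hX 6 (by exact_mod_cast hr)))
    rwa [show min 39 (6 + d) - 6 = min 33 d by omega] at this
  have h5 : {X : Set α | X ⊆ M.E ∧ M.eRk X = (5 : ℕ)}.ncard ≤ M.E.ncard.choose 5 * 2 ^ (min 14 d) := by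
    have := S2.ncard_eRk_eq_le_choose_mul_two_pow M 5 (min 19 (5 + d))
      (fun X hX hr => le_min (ncard_le_nineteen_of_eRk_le_five_of_free M hfree hX (by exact_mod_cast hr))
        (hcap X hX 5 (by exact_mod_cast hr)))
    rwa [show min 19 (5 + d) - 5 = min 14 d by omega] at this
  have h4 : {X : Set α | X ⊆ M.E ∧ M.eRk X = (4 : ℕ)}.ncard ≤ M.E.ncard.choose 4 * 2 ^ (10 - 4) :=
    S2.ncard_eRk_eq_le_choose_mul_two_pow M 4 10
      (fun X hX hr => ncard_le_ten_of_eRk_le_four_of_free M hfree hX (by exact_mod_cast hr))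
  have h3 : {X : Set α | X ⊆ M.E ∧ M.eRk X = (3 : ℕ)}.ncard ≤ M.E.ncard.choose 3 * 2 ^ (6 - 3) :=
    S2.ncard_eRk_eq_le_choose_mul_two_pow M 3 6
      (fun X hX hr => ncard_le_six_of_eRk_le_three_of_free M hfree hX (by exact_mod_cast hr))
  have h2 : {X : Set α | X ⊆ M.E ∧ M.eRk X = (2 : ℕ)}.ncard ≤ M.E.ncard.choose 2 * 2 ^ (3 - 2) :=
    S2.ncard_eRk_eq_le_choose_mul_two_pow M 2 3
      (fun X hX hr => by
        have := ncard_add_one_le_two_pow_of_eRk_le M hL0 hfree 2 X hX hr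
        omega)
  have h1 : {X : Set α | X ⊆ M.E ∧ M.eRk X = (1 : ℕ)}.ncard ≤ M.E.ncard.choose 1 * 2 ^ (1 - 1) :=
    S2.ncard_eRk_eq_le_choose_mul_two_pow M 1 1
      (fun X hX hr => by
        have := ncard_add_one_le_two_pow_of_eRk_le M hL0 hfree 1 X hX hr
        omega)
  have h0 : {X : Set α | X ⊆ M.E ∧ M.eRk X = (0 : ℕ)}.ncard ≤ M.E.ncard.choose 0 * 2 ^ (0 - 0) :=
    S2.ncard_eRk_eq_le_choose_mul_two_pow M 0 0
      (fun X hX hr => by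
        have := ncard_add_one_le_two_pow_of_eRk_le M hL0 hfree 0 X hX hr
        omega)
  simp only [Nat.choose_one_right, Nat.choose_zero_right, Nat.sub_self, pow_zero, mul_one] at h1 h0
  rw [hn] at h7 h6 h5 h4 h3 h2 h1
  push_cast at hsum7 h7 h6 h5 h4 h3 h2 h1 h0
  -- (Φ) and the polynomial inequality
  have hΦ := phiK_le_two_pow_div p 7
  rw [Nat.choose_symm_add] at hΦ
  rw [RLS_iff]
  have hYq : (2 : ℚ) ^ (p + d) ≤ (Matroid.midCount M p 7 : ℚ) +
      ({X : Set α | X ⊆ M.E ∧ M.eRk X ≤ 7}.ncard : ℚ) +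
      ({X : Set α | X ⊆ M.E ∧ M.eRk X = M.eRank}.ncard : ℚ) := by exact_mod_cast hY
  have hU0' : (0 : ℚ) ≤ (Matroid.topCount M p 7 : ℚ) := Nat.cast_nonneg _
  have hd7 : 7 ≤ d := by omega
  have hc1q : (0 : ℚ) ≤ (c₁ : ℚ) := Nat.cast_nonneg _
  -- the sets of rank `≤ 6`
  have hA6 : {X : Set α | X ⊆ M.E ∧ M.eRk X ≤ 7}.ncard ≤ {X : Set α | X ⊆ M.E ∧ M.eRk X = 7}.ncard +
      ((p + d).choose 6 * 2 ^ (min 33 d) + (p + d).choose 5 * 2 ^ (min 14 d) + (p + d).choose 4 * 2 ^ 6 +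
        (p + d).choose 3 * 2 ^ 3 + (p + d).choose 2 * 2 + (p + d) + 1) := by
    omega
  -- the `U`-side: the Bonferroni recombination with the giant term `G`
  have hcount7 : ({B : Set α | B ⊆ M.E ∧ M.eRk B = 7 ∧ B.ncard ≤ d}.ncard : ℚ) ≤
      nsideTelK7 p d 0 S3 S4 S5 - (2 : ℚ) ^ (min 79 (7 + d - 0)) + (G : ℚ) :=
    count_le_nsideTelK7_giant M (G : ℚ) p d 0 S3 S4 S5 hd8 hn hn13 hs3 hs4 hs5 hs6 hs7 hs8 hC1 hU0
  have hUq7 : (Matroid.topCount M p 7 : ℚ) ≤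
      nsideTelK7 p d 0 S3 S4 S5 - (2 : ℚ) ^ (min 79 (7 + d - 0)) + (G : ℚ) :=
    (by exact_mod_cast hU1 : (Matroid.topCount M p 7 : ℚ) ≤
      ({B : Set α | B ⊆ M.E ∧ M.eRk B = 7 ∧ B.ncard ≤ d}.ncard : ℚ)).trans hcount7
  have hmain : (c₁ : ℚ) * (Matroid.topCount M p 7 : ℚ) ≤ (c₂ : ℚ) * 2 ^ (d - 7) * (((p + 7).choose 7 : ℕ) : ℚ) :=
    (mul_le_mul_of_nonneg_left hUq7 hc1q).trans hN
  -- the `Y`-side: all rank-`7` sets through the giant term, the ranks `≤ 6`, the spanning bound `TA`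
  have hA7q : (({X : Set α | X ⊆ M.E ∧ M.eRk X = 7}.ncard : ℕ) : ℚ) ≤
      (nsideTelK7 p d 0 S3 S4 S5 - (2 : ℚ) ^ (min 79 (7 + d - 0)) + (G : ℚ)) + (G : ℚ) := by
    have h1 : (({X : Set α | X ⊆ M.E ∧ M.eRk X = 7}.ncard : ℕ) : ℚ) ≤
        (({B : Set α | B ⊆ M.E ∧ M.eRk B = 7 ∧ B.ncard ≤ d}.ncard : ℕ) : ℚ) + (G : ℚ) := by
      exact_mod_cast hall
    linarith
  have hA6q : (({X : Set α | X ⊆ M.E ∧ M.eRk X ≤ 7}.ncard : ℕ) : ℚ) ≤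
      (({X : Set α | X ⊆ M.E ∧ M.eRk X = 7}.ncard : ℕ) : ℚ) +
      (((p + d).choose 6 * 2 ^ (min 33 d) + (p + d).choose 5 * 2 ^ (min 14 d) + (p + d).choose 4 * 2 ^ 6 +
        (p + d).choose 3 * 2 ^ 3 + (p + d).choose 2 * 2 + (p + d) + 1 : ℕ) : ℚ) := by exact_mod_cast hA6
  have hBq : ({X : Set α | X ⊆ M.E ∧ M.eRk X = M.eRank}.ncard : ℚ) ≤ ((TA : ℕ) : ℚ) := by exact_mod_cast hB
  have hsum : (({X : Set α | X ⊆ M.E ∧ M.eRk X ≤ 7}.ncard : ℕ) : ℚ) +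
      ({X : Set α | X ⊆ M.E ∧ M.eRk X = M.eRank}.ncard : ℚ) ≤
      (nsideTelK7 p d 0 S3 S4 S5 - (2 : ℚ) ^ (min 79 (7 + d - 0)) + (G : ℚ) + (G : ℚ)) +
      (((p + d).choose 6 * 2 ^ (min 33 d) + (p + d).choose 5 * 2 ^ (min 14 d) + (p + d).choose 4 * 2 ^ 6 +
        (p + d).choose 3 * 2 ^ 3 + (p + d).choose 2 * 2 + (p + d) + 1 + TA : ℕ) : ℚ) := by
    push_cast at hA6q hBq ⊢
    linarith
  have hABq : (c₁ : ℚ) * (({X : Set α | X ⊆ M.E ∧ M.eRk X ≤ 7}.ncard : ℚ) +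
      ({X : Set α | X ⊆ M.E ∧ M.eRk X = M.eRank}.ncard : ℚ)) ≤ ((c₁ - c₂ : ℕ) : ℚ) * 2 ^ (p + d) :=
    (mul_le_mul_of_nonneg_left hsum hc1q).trans hT
  have hUq' : (Matroid.topCount M p 7 : ℚ) ≤ (((p + d).choose 7 : ℕ) : ℚ) +
      ((Matroid.topCount M p 7 : ℚ) - (((p + d).choose 7 : ℕ) : ℚ)) := by linarith
  have hpolyq' : (c₁ : ℚ) * ((((p + d).choose 7 : ℕ) : ℚ) +
      ((Matroid.topCount M p 7 : ℚ) - (((p + d).choose 7 : ℕ) : ℚ))) ≤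
      (c₂ : ℚ) * 2 ^ (d - 7) * (((p + 7).choose 7 : ℕ) : ℚ) := by
    have : (((p + d).choose 7 : ℕ) : ℚ) + ((Matroid.topCount M p 7 : ℚ) - (((p + d).choose 7 : ℕ) : ℚ)) =
        (Matroid.topCount M p 7 : ℚ) := by ring
    rw [this]; exact hmain
  exact level_arith_form (p := p) (d := d) (n := p + d) (q := 7) rfl hd7 hc₂ hc₁₂ hΦ hU0' hUq' hYq hABq hpolyq'

end ThmN

end PercRepro
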